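import Summits.ResolutionOfSingularities.ResolutionOfSingularities.Theorems.FrobeniusClosingPatchingRelPerfectDepthFlagLegalTargets
import Summits.ResolutionOfSingularities.ResolutionOfSingularities.Theorems.FrobeniusClosingPatchingRelPerfectDepthFlagCascade
import Summits.ResolutionOfSingularities.ResolutionOfSingularities.Theorems.FrobeniusClosingPatchingRelPerfectDepthFlagSeqState
import Summits.ResolutionOfSingularities.ResolutionOfSingularities.Theorems.FrobeniusClosingPatchingRelPerfectDepthFlagSeqBookkeeping
import Summits.ResolutionOfSingularities.ResolutionOfSingularities.Theorems.FrobeniusClosingPatchingRelPerfectDepthFlagPrephaseHolds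
import Summits.ResolutionOfSingularities.ResolutionOfSingularities.Theorems.FrobeniusClosingPatchingRelPerfectDepthFlagSepCompositions
import Literature.AlgebraicGeometry.Resolution.BlowupOffCentre
import Literature.AlgebraicGeometry.Resolution.CartierDivisorControlledTransform
import Literature.AlgebraicGeometry.Resolution.RegularSubschemeLocallyIrreducible
import Literature.AlgebraicGeometry.Resolution.BlowupDisjointCentreWeights
import Literature.AlgebraicGeometry.Resolution.MarkedIdealsArithmetic
import Literature.AlgebraicGeometry.Resolution.MarkedIdealsLemmas
import Literature.AlgebraicGeometry.Resolution.KollarStep2Stage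
import Literature.AlgebraicGeometry.Hironaka2017.PermissibleLSB
import HarnessLib

/-!
# Chain W5.2 — «F6» stage 1: the PROVED glue around T6-E1/T6-E1b — factor transport along flag sequences,
# `EndGame₂` from `LegalDivisorReduction₃`, and the exact residual `LegalScopedDivisorReduction₃`
[OURS · L1 W5.2 · res-L1-w52-idea-1 gen 7 (IDEATOR 1, card C ROUND 8c; Sketch v9 §9–§11) · targets `…DepthFlagLegalTargets` ·
booked by res-L1-w52-plan-1 RULING R3 (a)]  Pure PROOFS, no definitions.  The ONLY named fact is F-32bR
`CossartJannsenSaito2020EmbeddedSequenceB` (Cossart–Jannsen–Saito 2020, Thm. 1.4), and it enters ONLY through res-type-049's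
`stageOnePrephase₃_of_cjsB` in the corollaries suffixed `_of_cjsB` (CONDITIONAL on it, exactly as the chain's other E-drivers);
everything else is fact-free.  F-33 does NOT occur.  NOT statements of the manuscript under review (Hironaka 2017); AI-written, AI
review is weaker than expert review.
RESULTS.  `isFlagSeq_transport_mul` (FACTOR TRANSPORT: a flag sequence for `(A, A₁)` carries any flag `(𝔟, R₁)` with
`𝔟 ⊔ R₁² = A · J`, `supp J ∩ supp A = ∅`, along the same centres; `J` inert, `A₁² ≤ A` persists) ·
`endGame₂_of_legalDivisorReduction₃` · glue `stageOneFlag₃_of_cascade_of_endGame` (+ scoped) · necessity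
`legalDivisorReduction₃_of_stageOneFlag₃`, `legalScopedDivisorReduction₃_of_stageOneFlagScoped₃` · `stageOneFlag₃_iff_legal` ·
the scoped seam `scopePhase₃_of_stageOnePrephase₃` / `_of_cjsB`, `legalDivisorReduction₃_of_scopePhase₃_of_scoped` · NET
`stageOneFlagScoped₃_iff_scoped_of_cjsB (hc : Cascade₂) (hCJS) : StageOneFlagScoped₃ ↔ LegalScopedDivisorReduction₃`,
`stageOneFlag₃_iff_scoped_of_cjsB`, `legalDivisorReduction₃_iff_scoped_of_cjsB`.
## References
* J. Kollár, *Lectures on Resolution of Singularities* (2007), 3.111 Step 3. [Kollar2007]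
* E. Bierstone, D. Grigoriev, P. Milman, J. Włodarczyk (2011), §3.2, Lemma 3.2.1. [BierstoneGrigorievMilmanWlodarczyk2011]
* V. Cossart, U. Jannsen, S. Saito, LNM 2270 (2020), Thm. 1.4. [CossartJannsenSaito2020]
-/

-- `Summit.<Summit>.<Sub>.Theorems` with `Sub = Summit` (single-conjunct summit, D-0017)
set_option linter.dupNamespace false

noncomputable section

open CategoryTheory CategoryTheory.Limits AlgebraicGeometry TopologicalSpace IsLocalRing
open Literature.AlgebraicGeometry.Resolution
open Scheme.IdealSheafData

namespace Summit.ResolutionOfSingularities.ResolutionOfSingularities.Theorems.DepthTargets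

universe u

/-- `A·C ≤ A` for ideal sheaves. [folklore] -/
private theorem mul_le_left' {Y : Scheme.{u}} (A C : Y.IdealSheafData) : A * C ≤ A := by
  have h : A * C ≤ A * 1 :=
    mul_le_mul_of_nonneg_left (by rw [Scheme.IdealSheafData.one_eq_top]; exact le_top) (by simp)
  simpa using h

/-- `K² ≤ K` for ideal sheaves. [folklore] -/
private theorem sq_le_self' {Y : Scheme.{u}} (K : Y.IdealSheafData) : K ^ 2 ≤ K := by
  rw [sq]; exact mul_le_left' K K

/-- The controlled transform is monotone in the ideal. [folklore] -/
private theorem controlledTransform_mono'' {Y' Y : Scheme.{u}} (τ : Y' ⟶ Y) (C : Y.IdealSheafData)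
    {H L : Y.IdealSheafData} (h : H ≤ L) (ν : ℕ) :
    controlledTransform τ C H ν ≤ controlledTransform τ C L ν :=
  colon_mono_left (Scheme.IdealSheafData.comap_mono (f := τ) h) _

/-- `ord_y I = 0` off the support. [folklore] -/
theorem idealOrder_eq_zero_of_not_mem_support {Y : Scheme.{u}} {I : Y.IdealSheafData} {y : Y}
    (h : y ∉ I.support) : idealOrder I y = 0 := by
  by_contra h0
  exact h ((one_le_idealOrder_iff I y).mp (Order.one_le_iff_ne_zero.mpr h0))

/-- Off `supp I` the product `I · J` has the order of `J`. [folklore] -/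
theorem idealOrder_mul_of_not_mem_support_left_flag {Y : Scheme.{u}} {I J : Y.IdealSheafData} {y : Y}
    (h : y ∉ I.support) : idealOrder (I * J) y = idealOrder J y := by
  refine ENat.eq_of_forall_natCast_le_iff fun n => ?_
  rw [le_idealOrder_iff, le_idealOrder_iff, stalkIdeal_mul, stalkIdeal_eq_top_of_not_mem_support h,
    Ideal.top_mul]

/-- Off `supp J` the product `I · J` has the order of `I`. [folklore] -/
theorem idealOrder_mul_of_not_mem_support_right_flag {Y : Scheme.{u}} {I J : Y.IdealSheafData} {y : Y}
    (h : y ∉ J.support) : idealOrder (I * J) y = idealOrder I y := by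
  refine ENat.eq_of_forall_natCast_le_iff fun n => ?_
  rw [le_idealOrder_iff, le_idealOrder_iff, stalkIdeal_mul, stalkIdeal_eq_top_of_not_mem_support h,
    Ideal.mul_top]

/-- No point lies in the support of the unit ideal sheaf. [folklore] -/
theorem not_mem_support_one {Y : Scheme.{u}} (y : Y) : y ∉ (1 : Y.IdealSheafData).support := fun h => by
  have h1 := (one_le_idealOrder_iff (1 : Y.IdealSheafData) y).mpr h
  rw [Scheme.IdealSheafData.one_eq_top, idealOrder_top] at h1
  exact absurd h1 (not_le.mpr zero_lt_one)

/-- **The flag transform law** `τᶜ(𝔟', 2) ⊔ (τᶜ(𝔟', 2) ⊔ τᶜ(R₁', 1))² = τᶜ(𝔟' ⊔ R₁'², 2)` for a flag-permissible centre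
(`𝔟' ≤ C²`, `R₁' ≤ C`). [folklore] -/
theorem flag_controlledTransform_sup_sq {Y' Y : Scheme.{u}} [IsLocallyNoetherian Y'] {τ : Y' ⟶ Y}
    {C 𝔟' R₁' : Y.IdealSheafData} (hτ : IsBlowup τ C) (h𝔟 : 𝔟' ≤ C ^ 2) (hR : R₁' ≤ C) :
    controlledTransform τ C 𝔟' 2 ⊔ (controlledTransform τ C 𝔟' 2 ⊔ controlledTransform τ C R₁' 1) ^ 2 =
      controlledTransform τ C (𝔟' ⊔ R₁' ^ 2) 2 := by
  have hD := hτ.isEffectiveCartier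
  have h1 : 𝔟'.comap τ ≤ C.comap τ ^ 2 := comap_le_comap_pow_of_le_pow h𝔟 τ
  have hR1' : R₁' ≤ C ^ 1 := by simpa using hR
  have hR1 : R₁'.comap τ ≤ C.comap τ ^ 1 := comap_le_comap_pow_of_le_pow hR1' τ
  have hR2 : (R₁' ^ 2).comap τ ≤ C.comap τ ^ 2 :=
    comap_le_comap_pow_of_le_pow (pow_le_pow_left₀ (by simp) hR 2) τ
  have hpow : controlledTransform τ C (R₁' ^ 2) 2 = controlledTransform τ C R₁' 1 ^ 2 := by
    simpa using controlledTransform_pow hD hR1 2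
  rw [controlledTransform_sup hD h1 hR2, hpow, DepthCascade.sup_sq_sup_eq]

/-! ## Factor transport along a flag sequence -/

/-- [OURS · L1 W5.2] **FACTOR TRANSPORT along a flag sequence** (regular locally Noetherian base): every flag `(𝔟, R₁)` with
`𝔟 ⊔ R₁² = A · J`, `supp J ∩ supp A = ∅` rides along the same centres; `J` is INERT (`𝔟' ⊔ R₁'² = A' · ρ^*J`,
`ρ⁻¹(supp J) ∩ supp A' = ∅`, `ord_{x'} ρ^*J = ord_{ρ x'} J`) and `A₁² ≤ A` persists. PROVED. [folklore]
[cite: BierstoneGrigorievMilmanWlodarczyk2011, §3.2, Lemma 3.2.1] -/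
theorem isFlagSeq_transport_mul :
    ∀ {E' E : Scheme.{u}} {ρ : E' ⟶ E} {A A₁ : E.IdealSheafData} {A' A₁' : E'.IdealSheafData},
      IsFlagSeq ρ A A₁ A' A₁' → IsLocallyNoetherian E → Scheme.IsRegular E →
      ∀ (𝔟 R₁ J : E.IdealSheafData), 𝔟 ⊔ R₁ ^ 2 = A * J →
        (∀ x, x ∈ J.support → x ∉ A.support) →
        ∃ 𝔟' R₁' : E'.IdealSheafData, IsFlagSeq ρ 𝔟 R₁ 𝔟' R₁' ∧
          𝔟' ⊔ R₁' ^ 2 = A' * J.comap ρ ∧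
          (∀ x', ρ x' ∈ J.support → x' ∉ A'.support) ∧
          (∀ x', idealOrder (J.comap ρ) x' = idealOrder J (ρ x')) ∧
          (A₁ ^ 2 ≤ A → A₁' ^ 2 ≤ A') ∧
          IsLocallyNoetherian E' ∧ Scheme.IsRegular E' := by
  intro E' E ρ A A₁ A' A₁' h
  induction h with
  | nil A A₁ =>
    intro hn hr 𝔟 R₁ J h𝒥 hdis
    refine ⟨𝔟, R₁, IsFlagSeq.nil 𝔟 R₁, by rw [Scheme.IdealSheafData.comap_id]; exact h𝒥,
      fun x' hx => hdis x' (by simpa using hx),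
      fun x' => by rw [Scheme.IdealSheafData.comap_id]; simp, id, hn, hr⟩
  | @cons E₃ E₂ E₁ τ ρ A A₁ A' A₁' C h hC hle hR hτ ih =>
    intro hn hr 𝔟 R₁ J h𝒥 hdis
    obtain ⟨𝔟', R₁', hfs, h𝒥', hdis', hord', hsq', hn', hr'⟩ := ih hn hr 𝔟 R₁ J h𝒥 hdis
    haveI := hn'
    -- legality of the centre for the transported flag
    have hAJ : A' * J.comap ρ ≤ A' := mul_le_left' _ _
    have h𝒥le : 𝔟' ⊔ R₁' ^ 2 ≤ C ^ 2 := (h𝒥'.le.trans hAJ).trans hle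
    have h𝔟'C : 𝔟' ≤ C ^ 2 := le_sup_left.trans h𝒥le; have hR2 : R₁' ^ 2 ≤ C ^ 2 := le_sup_right.trans h𝒥le
    have hCeq : C = vanishingIdeal C.support := eq_vanishingIdeal_support_of_isRegular C hC
    have hCreg : Scheme.IsRegular (vanishingIdeal C.support).subscheme := by rw [← hCeq]; exact hC
    have hordR : ∀ y ∈ (C.support : Set _), ((1 : ℕ) : ℕ∞) ≤ idealOrder R₁' y := by
      intro y hy
      haveI : IsRegularLocalRing _ := hr' y
      have hC1 : ((1 : ℕ) : ℕ∞) ≤ idealOrder C y := by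
        exact_mod_cast (one_le_idealOrder_iff C y).mpr hy
      have hC2 : (((2 * 1 : ℕ)) : ℕ∞) ≤ idealOrder (C ^ 2) y :=
        (le_idealOrder_pow_iff C (by norm_num) 1).mpr hC1
      have h2 : (((2 * 1 : ℕ)) : ℕ∞) ≤ idealOrder (R₁' ^ 2) y :=
        hC2.trans (DepthPeel.idealOrder_antitone hR2 y)
      exact (le_idealOrder_pow_iff R₁' (by norm_num) 1).mp h2
    have hR'C : R₁' ≤ C := by
      have h1 := Literature.AlgebraicGeometry.Hironaka2017.le_vanishingIdeal_pow_of_forall_le_idealOrder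
        hr' hCreg hordR
      rwa [pow_one, ← hCeq] at h1
    haveI : IsProper τ := hτ.isProper
    haveI hn'' : IsLocallyNoetherian E₃ := LocallyOfFiniteType.isLocallyNoetherian τ
    have hr'' : Scheme.IsRegular E₃ := IsBlowup.isRegular_of_isRegular_subscheme hr' hC hτ
    have hCA : ∀ y, y ∈ (C.support : Set _) → y ∈ A'.support := fun y hy =>
      Scheme.IdealSheafData.support_antitone (hle.trans (sq_le_self' C)) hy
    have hD := hτ.isEffectiveCartier
    refine ⟨controlledTransform τ C 𝔟' 2, controlledTransform τ C 𝔟' 2 ⊔ controlledTransform τ C R₁' 1,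
      IsFlagSeq.cons τ ρ 𝔟 R₁ 𝔟' R₁' C hfs hC h𝔟'C hR'C hτ, ?_, ?_, ?_, ?_, hn'', hr''⟩
    · -- factor law
      have hA2 : A'.comap τ ≤ C.comap τ ^ 2 := comap_le_comap_pow_of_le_pow hle τ
      have hJ0 : (J.comap ρ).comap τ ≤ C.comap τ ^ 0 := by
        rw [pow_zero, Scheme.IdealSheafData.one_eq_top]; exact le_top
      have hmul : controlledTransform τ C (A' * J.comap ρ) 2 =
          controlledTransform τ C A' 2 * controlledTransform τ C (J.comap ρ) 0 := by
        simpa using controlledTransform_mul hD hA2 hJ0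
      rw [flag_controlledTransform_sup_sq hτ h𝔟'C hR'C, h𝒥', hmul, controlledTransform_zero,
        ← Scheme.IdealSheafData.comap_comp]
    · -- disjointness
      intro x'' hx''
      have hx' : ρ (τ x'') ∈ J.support := by simpa [Scheme.Hom.comp_base] using hx''
      have h1 : τ x'' ∉ A'.support := hdis' (τ x'') hx'
      have h2 : τ x'' ∉ (C.support : Set _) := fun hc => h1 (hCA _ hc)
      exact fun h3 => h1 ((hτ.mem_support_controlledTransform_iff_of_not_mem 2 h2).mp h3)
    · -- orders of `J`
      intro x''
      have hcomp : (τ ≫ ρ) x'' = ρ (τ x'') := by simp [Scheme.Hom.comp_base]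
      rw [Scheme.IdealSheafData.comap_comp, hcomp]
      by_cases h2 : τ x'' ∈ (C.support : Set _)
      · have hJ : ρ (τ x'') ∉ J.support := fun hJ => hdis' (τ x'') hJ (hCA _ h2)
        have hJ' : x'' ∉ ((J.comap ρ).comap τ).support := fun h3 =>
          hJ ((mem_support_comap_iff ρ J _).mp ((mem_support_comap_iff τ (J.comap ρ) x'').mp h3))
        rw [idealOrder_eq_zero_of_not_mem_support hJ', idealOrder_eq_zero_of_not_mem_support hJ]
      · rw [hτ.idealOrder_comap_of_not_mem (J.comap ρ) h2, hord']
    · -- `A₁'² ≤ A'`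
      intro h0
      have ih2 := hsq' h0
      have hR1' : A₁' ≤ C ^ 1 := by simpa using hR
      have hR1 : A₁'.comap τ ≤ C.comap τ ^ 1 := comap_le_comap_pow_of_le_pow hR1' τ
      have hpow : controlledTransform τ C (A₁' ^ 2) 2 = controlledTransform τ C A₁' 1 ^ 2 := by
        simpa using controlledTransform_pow hD hR1 2
      have hY : controlledTransform τ C A₁' 1 ^ 2 ≤ controlledTransform τ C A' 2 := by
        rw [← hpow]; exact controlledTransform_mono'' τ C ih2 2
      calc (controlledTransform τ C A' 2 ⊔ controlledTransform τ C A₁' 1) ^ 2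
          ≤ controlledTransform τ C A' 2 ⊔
              (controlledTransform τ C A' 2 ⊔ controlledTransform τ C A₁' 1) ^ 2 := le_sup_right
        _ = controlledTransform τ C A' 2 ⊔ controlledTransform τ C A₁' 1 ^ 2 := DepthCascade.sup_sq_sup_eq _ _
        _ ≤ controlledTransform τ C A' 2 := sup_le le_rfl hY

/-- [OURS · L1 W5.2] on a DIAGONAL flag sequence `(H, H) ↦ (A', A₁')` one has `A₁'² ≤ A'`. PROVED. [folklore] -/
theorem isFlagSeq_diag_sq_le {E' E : Scheme.{u}} {ρ : E' ⟶ E} {H : E.IdealSheafData}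
    {A' A₁' : E'.IdealSheafData} (h : IsFlagSeq ρ H H A' A₁') (hn : IsLocallyNoetherian E)
    (hr : Scheme.IsRegular E) : A₁' ^ 2 ≤ A' := by
  obtain ⟨-, -, -, -, -, -, hsq, -, -⟩ := isFlagSeq_transport_mul h hn hr H H 1
    (by rw [mul_one]; exact sup_eq_left.mpr (sq_le_self' H)) (fun x hx => absurd hx (not_mem_support_one x))
  exact hsq (sq_le_self' H)

/-! ## The unscoped picture: `StageOneFlag₃` ↔ `LegalDivisorReduction₃` modulo `Cascade₂` -/

/-- [OURS · L1 W5.2] **GLUE: `StageOneFlag₃` from `Cascade₂` and `EndGame₂`.** PROVED. -/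
theorem stageOneFlag₃_of_cascade_of_endGame (hc : Cascade₂.{u}) (he : EndGame₂.{u}) :
    StageOneFlag₃.{u} := by
  intro E _ _ hreg hexc hdim 𝔟 R₁ h𝔟 hlp hle
  obtain ⟨E', ρ, 𝔟', R₁', hfs, hst, hend⟩ := hc E hreg hexc hdim 𝔟 R₁ h𝔟 hlp hle
  obtain ⟨E'', ρ', 𝔟'', R₁'', hfs', hst', hEnd⟩ := he E' 𝔟' R₁' hst hend
  exact ⟨E'', ρ' ≫ ρ, 𝔟'', R₁'', hfs.trans hfs', hst', hEnd⟩

/-- [OURS · L1 W5.2] **GLUE: `StageOneFlagScoped₃` from `Cascade₂` and `EndGame₂`** (scope unused). PROVED. -/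
theorem stageOneFlagScoped₃_of_cascade_of_endGame (hc : Cascade₂.{u}) (he : EndGame₂.{u}) :
    StageOneFlagScoped₃.{u} := by
  intro E _ _ hreg hexc hdim 𝔟 R₁ h𝔟 hlp hle _
  exact stageOneFlag₃_of_cascade_of_endGame hc he E hreg hexc hdim 𝔟 R₁ h𝔟 hlp hle

/-- [OURS · L1 W5.2] **NECESSITY: any closer of `StageOneFlag₃` proves `LegalDivisorReduction₃`** (diagonal). PROVED. -/
theorem legalDivisorReduction₃_of_stageOneFlag₃ (h : StageOneFlag₃.{u}) : LegalDivisorReduction₃.{u} := by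
  intro E _ _ hreg hexc hdim H hH hlp
  exact h E hreg hexc hdim H H hH hlp le_rfl

/-- [OURS · L1 W5.2] **NECESSITY: any closer of `StageOneFlagScoped₃` (T6-E1b) proves `LegalScopedDivisorReduction₃`.**
PROVED. -/
theorem legalScopedDivisorReduction₃_of_stageOneFlagScoped₃ (h : StageOneFlagScoped₃.{u}) :
    LegalScopedDivisorReduction₃.{u} := by
  intro E _ _ hreg hexc hdim H hH hlp hsc
  exact h E hreg hexc hdim H H hH hlp le_rfl hsc

/-- [OURS · L1 W5.2] the unscoped residual gives the scoped one. PROVED. -/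
theorem legalScopedDivisorReduction₃_of_legalDivisorReduction₃ (h : LegalDivisorReduction₃.{u}) :
    LegalScopedDivisorReduction₃.{u} := by
  intro E _ _ hreg hexc hdim H hH hlp _
  exact h E hreg hexc hdim H hH hlp

/-- [OURS · L1 W5.2] **`EndGame₂` from `LegalDivisorReduction₃`**: with `CascadeEnd₂`'s `𝒥 = H · J` run the diagonal game of
`H` and transport; at the end `ord (A'·J') ≤ 1` (over `supp J`: `A'` unit, `ord J' = ord J ≤ 1`; elsewhere `J'` unit, `ord A' ≤ 1`
by the diagonal `EndFlag`). PROVED. [cite: Kollar2007, 3.111 Step 3] -/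
theorem endGame₂_of_legalDivisorReduction₃ (hl : LegalDivisorReduction₃.{u}) : EndGame₂.{u} := by
  intro E 𝔟 R₁ hfs hce
  obtain ⟨hint, hnoeth, hreg, hexc, hdim, hne, hlp, hle⟩ := hfs
  haveI := hint; haveI := hnoeth
  obtain ⟨H, J, h𝒥, hH, hJ1, hdisj⟩ := hce
  have hH0 : H ≠ ⊥ := by
    intro h0
    have h1 : 𝔟 ⊔ R₁ ^ 2 = ⊥ := by rw [h𝒥, h0, mul_comm, Scheme.IdealSheafData.mul_bot]
    exact hne (le_bot_iff.mp (le_sup_left.trans h1.le))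
  obtain ⟨E', ρ, A', A₁', hdiag, hfs', hend'⟩ := hl E hreg hexc hdim H hH0 hH.isLocallyPrincipal
  have hdis0 : ∀ x, x ∈ J.support → x ∉ H.support := by
    intro x hx hxH
    have h2 := hdisj x ((one_le_idealOrder_iff J x).mpr hx)
    exact absurd (h2 ▸ (one_le_idealOrder_iff H x).mpr hxH) (not_le.mpr zero_lt_one)
  obtain ⟨𝔟', R₁', hflag, h𝒥', hdis', hord', hsq', -, -⟩ :=
    isFlagSeq_transport_mul hdiag inferInstance hreg 𝔟 R₁ J h𝒥 hdis0
  refine ⟨E', ρ, 𝔟', R₁', hflag, hflag.flagState₃ ⟨hint, hnoeth, hreg, hexc, hdim, hne, hlp, hle⟩, ?_⟩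
  have hA'eq : A' ⊔ A₁' ^ 2 = A' := sup_eq_left.mpr (hsq' (sq_le_self' H))
  intro x'
  rw [h𝒥']
  by_cases hx : ρ x' ∈ J.support
  · rw [idealOrder_mul_of_not_mem_support_left_flag (hdis' x' hx), hord' x']
    exact hJ1 _
  · have hJ0 : idealOrder (J.comap ρ) x' = 0 := by
      rw [hord' x']; exact idealOrder_eq_zero_of_not_mem_support hx
    have hJ' : x' ∉ (J.comap ρ).support := fun h =>
      absurd (hJ0 ▸ (one_le_idealOrder_iff (J.comap ρ) x').mpr h) (not_le.mpr zero_lt_one)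
    rw [idealOrder_mul_of_not_mem_support_right_flag hJ']
    have h1 := hend' x'
    rwa [hA'eq] at h1

/-- [OURS · L1 W5.2] `Cascade₂ → LegalDivisorReduction₃ → StageOneFlag₃`. PROVED. -/
theorem stageOneFlag₃_of_cascade_of_legal (hc : Cascade₂.{u}) (hl : LegalDivisorReduction₃.{u}) :
    StageOneFlag₃.{u} :=
  stageOneFlag₃_of_cascade_of_endGame hc (endGame₂_of_legalDivisorReduction₃ hl)

/-- [OURS · L1 W5.2] `Cascade₂ → LegalDivisorReduction₃ → StageOneFlagScoped₃`. PROVED. -/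
theorem stageOneFlagScoped₃_of_cascade_of_legal (hc : Cascade₂.{u}) (hl : LegalDivisorReduction₃.{u}) :
    StageOneFlagScoped₃.{u} :=
  stageOneFlagScoped₃_of_cascade_of_endGame hc (endGame₂_of_legalDivisorReduction₃ hl)

/-- [OURS · L1 W5.2] **modulo `Cascade₂`, `StageOneFlag₃` IS `LegalDivisorReduction₃`.** PROVED. -/
theorem stageOneFlag₃_iff_legal (hc : Cascade₂.{u}) : StageOneFlag₃.{u} ↔ LegalDivisorReduction₃.{u} :=
  ⟨legalDivisorReduction₃_of_stageOneFlag₃, stageOneFlag₃_of_cascade_of_legal hc⟩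

/-! ## The scoped seam: `ScopePhase₃` -/

/-- [OURS · L1 W5.2] `LegalDivisorReduction₃ → ScopePhase₃` (`EndFlag ⇒ FlagScope` vacuously). PROVED. -/
theorem scopePhase₃_of_legalDivisorReduction₃ (h : LegalDivisorReduction₃.{u}) : ScopePhase₃.{u} := by
  intro E _ _ hreg hexc hdim H hH hlp
  obtain ⟨E', ρ, A', A₁', hfs, hst, hend⟩ := h E hreg hexc hdim H hH hlp
  exact ⟨E', ρ, A', A₁', hfs, hst, fun x hx => absurd (hx.trans (hend x)) (by simp)⟩

/-- [OURS · L1 W5.2] `StageOnePrephase₃ → ScopePhase₃` (diagonal specialisation of T6-E1a). PROVED. -/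
theorem scopePhase₃_of_stageOnePrephase₃ (h : StageOnePrephase₃.{u}) : ScopePhase₃.{u} := by
  intro E _ _ hreg hexc hdim H hH hlp
  exact h E hreg hexc hdim H H hH hlp le_rfl

/-- [OURS · L1 W5.2] **`ScopePhase₃` modulo F-32bR**, by res-type-049's `stageOnePrephase₃_of_cjsB`. PROVED (CONDITIONAL on
the named fact F-32bR `CossartJannsenSaito2020EmbeddedSequenceB`). [cite: CossartJannsenSaito2020, Thm. 1.4] -/
theorem scopePhase₃_of_cjsB (hCJS : CossartJannsenSaito2020EmbeddedSequenceB.{u}) : ScopePhase₃.{u} :=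
  scopePhase₃_of_stageOnePrephase₃ (stageOnePrephase₃_of_cjsB hCJS)

/-- [OURS · L1 W5.2] **`ScopePhase₃ → LegalScopedDivisorReduction₃ → LegalDivisorReduction₃`**: reach scope legally, run the
scoped reduction on `A'` (the flags `(A', A')`, `(A', A₁')` share the marked ideal `A'`), transport with `J = 1`. PROVED. -/
theorem legalDivisorReduction₃_of_scopePhase₃_of_scoped (hp : ScopePhase₃.{u})
    (hs : LegalScopedDivisorReduction₃.{u}) : LegalDivisorReduction₃.{u} := by
  intro E _ _ hreg hexc hdim H hH hlp
  obtain ⟨E', ρ, A', A₁', hfs, hst, hsc⟩ := hp E hreg hexc hdim H hH hlp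
  obtain ⟨hint', hnoeth', hreg', hexc', hdim', hne', hlp', hle'⟩ := hst
  haveI := hint'; haveI := hnoeth'
  have hsq : A₁' ^ 2 ≤ A' := isFlagSeq_diag_sq_le hfs inferInstance hreg
  have hAeq : A' ⊔ A₁' ^ 2 = A' := sup_eq_left.mpr hsq
  have hscA : FlagScope A' A' := fun x hx => by
    rw [sup_eq_left.mpr (sq_le_self' A')] at hx
    exact hsc x (by rw [hAeq]; exact hx)
  obtain ⟨E'', ρ', A'', A₁'', hfs', hst', hend'⟩ := hs E' hreg' hexc' hdim' A' hne' hlp' hscA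
  obtain ⟨𝔟'', R₁'', hflag, h𝒥, -, -, hsq', -, -⟩ :=
    isFlagSeq_transport_mul hfs' inferInstance hreg' A' A₁' 1 (by rw [mul_one]; exact hAeq)
      (fun x hx => absurd hx (not_mem_support_one x))
  refine ⟨E'', ρ' ≫ ρ, 𝔟'', R₁'', hfs.trans hflag,
    hflag.flagState₃ ⟨hint', hnoeth', hreg', hexc', hdim', hne', hlp', hle'⟩, ?_⟩
  have hA''eq : A'' ⊔ A₁'' ^ 2 = A'' := sup_eq_left.mpr (hsq' (sq_le_self' A'))
  intro x'
  rw [h𝒥]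
  have hJ' : x' ∉ ((1 : E'.IdealSheafData).comap ρ').support := fun h =>
    not_mem_support_one (ρ' x') ((mem_support_comap_iff ρ' 1 x').mp h)
  rw [idealOrder_mul_of_not_mem_support_right_flag hJ']
  have h1 := hend' x'
  rwa [hA''eq] at h1

/-- [OURS · L1 W5.2] `Cascade₂ → ScopePhase₃ → LegalScopedDivisorReduction₃ → StageOneFlagScoped₃`. PROVED. -/
theorem stageOneFlagScoped₃_of_cascade_of_scopePhase₃_of_scoped (hc : Cascade₂.{u}) (hp : ScopePhase₃.{u})
    (hs : LegalScopedDivisorReduction₃.{u}) : StageOneFlagScoped₃.{u} :=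
  stageOneFlagScoped₃_of_cascade_of_legal hc (legalDivisorReduction₃_of_scopePhase₃_of_scoped hp hs)

/-- [OURS · L1 W5.2] modulo ⟨`Cascade₂`, `ScopePhase₃`⟩, `StageOneFlagScoped₃ ↔ LegalScopedDivisorReduction₃`. PROVED. -/
theorem stageOneFlagScoped₃_iff_scoped (hc : Cascade₂.{u}) (hp : ScopePhase₃.{u}) :
    StageOneFlagScoped₃.{u} ↔ LegalScopedDivisorReduction₃.{u} :=
  ⟨legalScopedDivisorReduction₃_of_stageOneFlagScoped₃, stageOneFlagScoped₃_of_cascade_of_scopePhase₃_of_scoped hc hp⟩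

/-- [OURS · L1 W5.2] modulo `ScopePhase₃`, `LegalDivisorReduction₃ ↔ LegalScopedDivisorReduction₃`. PROVED. -/
theorem legalDivisorReduction₃_iff_scoped (hp : ScopePhase₃.{u}) :
    LegalDivisorReduction₃.{u} ↔ LegalScopedDivisorReduction₃.{u} :=
  ⟨legalScopedDivisorReduction₃_of_legalDivisorReduction₃, legalDivisorReduction₃_of_scopePhase₃_of_scoped hp⟩

/-! ## NET, modulo ⟨`Cascade₂`, F-32bR⟩ -/

/-- [OURS · L1 W5.2] **T6-E1b from ⟨`Cascade₂`, F-32bR, `LegalScopedDivisorReduction₃`⟩.** PROVED (CONDITIONAL on F-32bR). -/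
theorem stageOneFlagScoped₃_of_cascade_of_cjsB_of_scoped (hc : Cascade₂.{u})
    (hCJS : CossartJannsenSaito2020EmbeddedSequenceB.{u}) (hs : LegalScopedDivisorReduction₃.{u}) :
    StageOneFlagScoped₃.{u} :=
  stageOneFlagScoped₃_of_cascade_of_scopePhase₃_of_scoped hc (scopePhase₃_of_cjsB hCJS) hs

/-- [OURS · L1 W5.2] **modulo ⟨`Cascade₂`, F-32bR⟩, T6-E1b `StageOneFlagScoped₃` IS `LegalScopedDivisorReduction₃`.**
PROVED (CONDITIONAL on F-32bR). -/
theorem stageOneFlagScoped₃_iff_scoped_of_cjsB (hc : Cascade₂.{u})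
    (hCJS : CossartJannsenSaito2020EmbeddedSequenceB.{u}) :
    StageOneFlagScoped₃.{u} ↔ LegalScopedDivisorReduction₃.{u} :=
  stageOneFlagScoped₃_iff_scoped hc (scopePhase₃_of_cjsB hCJS)

/-- [OURS · L1 W5.2] **modulo ⟨`Cascade₂`, F-32bR⟩, T6-E1 `StageOneFlag₃` IS `LegalScopedDivisorReduction₃` too**
(plan-1's `stageOneFlag₃_of_prephase_of_scoped` + res-type-049's prephase). PROVED (CONDITIONAL on F-32bR). -/
theorem stageOneFlag₃_iff_scoped_of_cjsB (hc : Cascade₂.{u})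
    (hCJS : CossartJannsenSaito2020EmbeddedSequenceB.{u}) :
    StageOneFlag₃.{u} ↔ LegalScopedDivisorReduction₃.{u} :=
  ⟨fun h => legalScopedDivisorReduction₃_of_legalDivisorReduction₃ (legalDivisorReduction₃_of_stageOneFlag₃ h),
    fun h => stageOneFlag₃_of_prephase_of_scoped (stageOnePrephase₃_of_cjsB hCJS)
      (stageOneFlagScoped₃_of_cascade_of_cjsB_of_scoped hc hCJS h)⟩

/-- [OURS · L1 W5.2] **modulo F-32bR the scoped and unscoped residuals coincide.** PROVED (CONDITIONAL on F-32bR). -/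
theorem legalDivisorReduction₃_iff_scoped_of_cjsB (hCJS : CossartJannsenSaito2020EmbeddedSequenceB.{u}) :
    LegalDivisorReduction₃.{u} ↔ LegalScopedDivisorReduction₃.{u} :=
  legalDivisorReduction₃_iff_scoped (scopePhase₃_of_cjsB hCJS)

end Summit.ResolutionOfSingularities.ResolutionOfSingularities.Theorems.DepthTargets

end
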